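import Summits.Ventures.Crystal3D.Theorems.StickyWulffConstantPolycrystalWulffBoundTwinSectionShiftCubic

/-!
# `PolycrystalWulffBound`, line `PolyDensity`: the twin section shift of the TRUNCATED OCTAHEDRON is at
# most `sin∠(n, [111]) / √6` — kernel proof in the cubic frame (crux `stmt-Ventures-19482`)

Route `StickyWulffConstant` of the venture `Summits/Ventures/Crystal3D`, second prover lane (poly-p2,
gen 9).  For the fcc Wulff body `W = conv{perm(0,±1,±2)}` (`Literature.….fccWulffBody`), its twin
`R_{[111]} W` (mirror across `(1,1,1)^⊥`) and ANY unit normal `n`, for all `t`: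

  `|R_{[111]} W ∩ {⟪x, n⟫ < t}| ≤ |W ∩ {⟪x, n⟫ < t + (1/√6)·√(1 − ⟪n,(1,1,1)⟫²/3)}|`

(`fccWulffBody_twin_cdf_le`): the cumulative section volumes of the twin pair along `n` are shifts of
each other by at most `sin∠(n,[111])/√6`, the constant of poly-p2 g8's table (memo P-TWIN-g8 §2a: the
numerically sharp `c = 1/√6 = 0.408`, attained at the `⟨111⟩′` poles; the crux charges `c₁ = 1/2`).
PROOF, no numerics: (1) isometry covariance and `W = −W` turn the left side into
`|W ∩ {⟪x, n''⟫ < t}|` with `n'' = −R_{[111]} n` (`= n` reflected across the plane through `[111]` and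
`n`); (2) for each zone `k` the `{1 -1 0}`-type mirror `σ_k` of `W` (a coordinate swap) satisfies the
IDENTITY `n'' = R_{d_k}(σ_k n)` with `d_k ∈ {(−2,1,1),(1,−2,1),(1,1,−2)}` and
`⟪d_k, σ_k n⟫ = s − 3 n_k` (`s = n₀+n₁+n₂`); (3) `exists_zone_le`: for SOME `k`,
`2(s − 3n_k)² ≤ 3 − s²`, i.e. `|⟪d_k/√6, σ_k n⟫| ≤ ½ sin∠(n,[111])`; (4) the chord flip along `d_k`
(`volume_inter_lt_reflect_le_of_cap_div` with the cap reflection `cap_reflect_mem_fccWulffBody_k` of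
`…TwinSectionShiftCubic.lean`) shifts the cumulative volume by at most `2·(1/√6)·|⟪d_k/√6, σ_k n⟫|`,
and `σ_k` costs nothing.
WHAT THIS IS NOT: the crux-vocabulary statement `TwinSectionShift (1/√6)` (transport to the crux's
`W(A)`, `Ax m A B`: `…TwinSectionShiftHolds.lean`); the crux is not claimed. -/

noncomputable section

open scoped BigOperators InnerProductSpace ENNReal
open MeasureTheory Set

namespace Summit.Ventures.Crystal3D.Theorems

open Summit.Ventures.Crystal3D.Cruxes.TextureLiminf.TexShadow (E3)
open Literature.MathematicalPhysics.StatisticalMechanics (fccWulffBody mem_fccWulffBody_iff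
  isCompact_fccWulffBody convex_fccWulffBody)

/-! ### Choice of the zone -/

/-- **One of the three zones is good.**  For reals `n₀, n₁, n₂` with `s = n₀ + n₁ + n₂`, some `k` has
`2 (s − 3 n_k)² ≤ 3 (n₀² + n₁² + n₂²) − s²` (for a unit vector: the component of `n` orthogonal to
`(1,1,1)` makes an angle `≤ 30°` with one of the three `{1 -1 0}` mirror lines). -/
theorem exists_zone_le (n₀ n₁ n₂ : ℝ) :
    2 * (n₀ + n₁ + n₂ - 3 * n₀) ^ 2 ≤ 3 * (n₀ ^ 2 + n₁ ^ 2 + n₂ ^ 2) - (n₀ + n₁ + n₂) ^ 2 ∨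
    2 * (n₀ + n₁ + n₂ - 3 * n₁) ^ 2 ≤ 3 * (n₀ ^ 2 + n₁ ^ 2 + n₂ ^ 2) - (n₀ + n₁ + n₂) ^ 2 ∨
    2 * (n₀ + n₁ + n₂ - 3 * n₂) ^ 2 ≤ 3 * (n₀ ^ 2 + n₁ ^ 2 + n₂ ^ 2) - (n₀ + n₁ + n₂) ^ 2 := by
  have e1 : 3 * (n₀ ^ 2 + n₁ ^ 2 + n₂ ^ 2) - (n₀ + n₁ + n₂) ^ 2 - 2 * (n₀ + n₁ + n₂ - 3 * n₁) ^ 2 =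
      6 * ((n₁ - n₀) * (n₂ - n₁)) := by ring
  have e0 : 3 * (n₀ ^ 2 + n₁ ^ 2 + n₂ ^ 2) - (n₀ + n₁ + n₂) ^ 2 - 2 * (n₀ + n₁ + n₂ - 3 * n₀) ^ 2 =
      -(6 * ((n₁ - n₀) * (n₂ - n₀))) := by ring
  have e2 : 3 * (n₀ ^ 2 + n₁ ^ 2 + n₂ ^ 2) - (n₀ + n₁ + n₂) ^ 2 - 2 * (n₀ + n₁ + n₂ - 3 * n₂) ^ 2 =
      -(6 * ((n₂ - n₁) * (n₂ - n₀))) := by ring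
  by_cases hab : 0 ≤ (n₁ - n₀) * (n₂ - n₁)
  · exact Or.inr (Or.inl (by linarith))
  · by_cases h0 : (n₁ - n₀) * (n₂ - n₀) ≤ 0
    · exact Or.inl (by linarith)
    · refine Or.inr (Or.inr ?_)
      have hab' : (n₁ - n₀) * (n₂ - n₁) < 0 := lt_of_not_ge hab
      have h0' : 0 < (n₁ - n₀) * (n₂ - n₀) := lt_of_not_ge h0
      have h2 : (n₂ - n₁) * (n₂ - n₀) ≤ 0 := by
        by_contra h
        have h' : 0 < (n₂ - n₁) * (n₂ - n₀) := lt_of_not_ge h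
        have hprod := mul_pos h0' h'
        nlinarith [sq_nonneg (n₂ - n₀)]
      linarith

/-- The size of the shift: `2·1·|q|/6 ≤ (1/√6)·√(1 − s²/3)` when `2q² ≤ 3 − s²`. -/
theorem shift_le_of_sq_le {q s : ℝ} (h : 2 * q ^ 2 ≤ 3 - s ^ 2) :
    2 * 1 * |q| / 6 ≤ 1 / Real.sqrt 6 * Real.sqrt (1 - s ^ 2 / 3) := by
  have hy : 0 ≤ 1 - s ^ 2 / 3 := by nlinarith [sq_nonneg q]
  have hlhs : 2 * 1 * |q| / 6 = |q / 3| := by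
    rw [abs_div, abs_of_pos (by norm_num : (0 : ℝ) < 3)]
    ring
  have hrhs : 1 / Real.sqrt 6 * Real.sqrt (1 - s ^ 2 / 3) = Real.sqrt ((1 - s ^ 2 / 3) / 6) := by
    rw [Real.sqrt_div hy 6]
    ring
  rw [hlhs, hrhs]
  refine Real.abs_le_sqrt ?_
  have : (q / 3) ^ 2 = q ^ 2 / 9 := by ring
  rw [this]
  linarith

/-! ### The twin identities of the three zones -/

/-- The twin mirror in coordinates: `−R_{(1,1,1)} n = (2s/3)(1,1,1) − n`, `s = n₀ + n₁ + n₂`. -/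
theorem neg_reflection_diag_apply (n : E3) :
    -((ℝ ∙ (!₂[(1 : ℝ), 1, 1] : E3))ᗮ.reflection n) =
      (2 * (n 0 + n 1 + n 2) / 3) • (!₂[(1 : ℝ), 1, 1] : E3) - n := by
  rw [reflection_orthogonal_apply_div, (inner_cubic_vectors n).1, norm_sq_cubic_vectors.1, neg_sub]

/-- The `{1 -1 0}` mirrors in coordinates on literals. -/
theorem reflection_swap_coords (n : E3) :
    ((ℝ ∙ (EuclideanSpace.single 1 (1 : ℝ) - EuclideanSpace.single 2 (1 : ℝ)))ᗮ.reflection n 0 = n 0 ∧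
      (ℝ ∙ (EuclideanSpace.single 1 (1 : ℝ) - EuclideanSpace.single 2 (1 : ℝ)))ᗮ.reflection n 1 = n 2 ∧
      (ℝ ∙ (EuclideanSpace.single 1 (1 : ℝ) - EuclideanSpace.single 2 (1 : ℝ)))ᗮ.reflection n 2 = n 1) ∧
    ((ℝ ∙ (EuclideanSpace.single 0 (1 : ℝ) - EuclideanSpace.single 2 (1 : ℝ)))ᗮ.reflection n 0 = n 2 ∧
      (ℝ ∙ (EuclideanSpace.single 0 (1 : ℝ) - EuclideanSpace.single 2 (1 : ℝ)))ᗮ.reflection n 1 = n 1 ∧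
      (ℝ ∙ (EuclideanSpace.single 0 (1 : ℝ) - EuclideanSpace.single 2 (1 : ℝ)))ᗮ.reflection n 2 = n 0) ∧
    ((ℝ ∙ (EuclideanSpace.single 0 (1 : ℝ) - EuclideanSpace.single 1 (1 : ℝ)))ᗮ.reflection n 0 = n 1 ∧
      (ℝ ∙ (EuclideanSpace.single 0 (1 : ℝ) - EuclideanSpace.single 1 (1 : ℝ)))ᗮ.reflection n 1 = n 0 ∧
      (ℝ ∙ (EuclideanSpace.single 0 (1 : ℝ) - EuclideanSpace.single 1 (1 : ℝ)))ᗮ.reflection n 2 = n 2) := by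
  have h12 : (1 : Fin 3) ≠ 2 := by decide
  have h02 : (0 : Fin 3) ≠ 2 := by decide
  have h01 : (0 : Fin 3) ≠ 1 := by decide
  refine ⟨⟨?_, ?_, ?_⟩, ⟨?_, ?_, ?_⟩, ⟨?_, ?_, ?_⟩⟩
  · rw [reflection_swap_apply h12, Equiv.swap_apply_of_ne_of_ne h01 h02]
  · rw [reflection_swap_apply h12, Equiv.swap_apply_left]
  · rw [reflection_swap_apply h12, Equiv.swap_apply_right]
  · rw [reflection_swap_apply h02, Equiv.swap_apply_left]
  · rw [reflection_swap_apply h02, Equiv.swap_apply_of_ne_of_ne h01.symm h12]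
  · rw [reflection_swap_apply h02, Equiv.swap_apply_right]
  · rw [reflection_swap_apply h01, Equiv.swap_apply_left]
  · rw [reflection_swap_apply h01, Equiv.swap_apply_right]
  · rw [reflection_swap_apply h01, Equiv.swap_apply_of_ne_of_ne h02.symm h12.symm]

/-- **Twin identity, zone `0`**: `−R_{(1,1,1)} n = R_{(−2,1,1)}(σ₁₂ n)` and
`⟪(−2,1,1), σ₁₂ n⟫ = s − 3n₀`. -/
theorem twin_identity₀ (n : E3) :
    -((ℝ ∙ (!₂[(1 : ℝ), 1, 1] : E3))ᗮ.reflection n) =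
      (ℝ ∙ (EuclideanSpace.single 1 (1 : ℝ) - EuclideanSpace.single 2 (1 : ℝ)))ᗮ.reflection n -
        (2 * ⟪(!₂[(-2 : ℝ), 1, 1] : E3),
          (ℝ ∙ (EuclideanSpace.single 1 (1 : ℝ) - EuclideanSpace.single 2 (1 : ℝ)))ᗮ.reflection n⟫_ℝ / 6) •
        (!₂[(-2 : ℝ), 1, 1] : E3) ∧
    ⟪(!₂[(-2 : ℝ), 1, 1] : E3),
        (ℝ ∙ (EuclideanSpace.single 1 (1 : ℝ) - EuclideanSpace.single 2 (1 : ℝ)))ᗮ.reflection n⟫_ℝ =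
      n 0 + n 1 + n 2 - 3 * n 0 := by
  obtain ⟨⟨h0, h1, h2⟩, -, -⟩ := reflection_swap_coords n
  have hin : ⟪(!₂[(-2 : ℝ), 1, 1] : E3),
      (ℝ ∙ (EuclideanSpace.single 1 (1 : ℝ) - EuclideanSpace.single 2 (1 : ℝ)))ᗮ.reflection n⟫_ℝ =
      n 0 + n 1 + n 2 - 3 * n 0 := by
    rw [(inner_cubic_vectors _).2.2.2, h0, h1, h2]; ring
  refine ⟨?_, hin⟩
  rw [neg_reflection_diag_apply, hin]
  ext l
  fin_cases l
  · simp [h0]; ring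
  · simp [h1]; ring
  · simp [h2]; ring

/-- **Twin identity, zone `1`**: `−R_{(1,1,1)} n = R_{(1,−2,1)}(σ₀₂ n)`, `⟪(1,−2,1), σ₀₂ n⟫ = s − 3n₁`. -/
theorem twin_identity₁ (n : E3) :
    -((ℝ ∙ (!₂[(1 : ℝ), 1, 1] : E3))ᗮ.reflection n) =
      (ℝ ∙ (EuclideanSpace.single 0 (1 : ℝ) - EuclideanSpace.single 2 (1 : ℝ)))ᗮ.reflection n -
        (2 * ⟪(!₂[(1 : ℝ), -2, 1] : E3),
          (ℝ ∙ (EuclideanSpace.single 0 (1 : ℝ) - EuclideanSpace.single 2 (1 : ℝ)))ᗮ.reflection n⟫_ℝ / 6) •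
        (!₂[(1 : ℝ), -2, 1] : E3) ∧
    ⟪(!₂[(1 : ℝ), -2, 1] : E3),
        (ℝ ∙ (EuclideanSpace.single 0 (1 : ℝ) - EuclideanSpace.single 2 (1 : ℝ)))ᗮ.reflection n⟫_ℝ =
      n 0 + n 1 + n 2 - 3 * n 1 := by
  obtain ⟨-, ⟨h0, h1, h2⟩, -⟩ := reflection_swap_coords n
  have hin : ⟪(!₂[(1 : ℝ), -2, 1] : E3),
      (ℝ ∙ (EuclideanSpace.single 0 (1 : ℝ) - EuclideanSpace.single 2 (1 : ℝ)))ᗮ.reflection n⟫_ℝ =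
      n 0 + n 1 + n 2 - 3 * n 1 := by
    rw [(inner_cubic_vectors _).2.2.1, h0, h1, h2]; ring
  refine ⟨?_, hin⟩
  rw [neg_reflection_diag_apply, hin]
  ext l
  fin_cases l
  · simp [h0]; ring
  · simp [h1]; ring
  · simp [h2]; ring

/-- **Twin identity, zone `2`**: `−R_{(1,1,1)} n = R_{(1,1,−2)}(σ₀₁ n)`, `⟪(1,1,−2), σ₀₁ n⟫ = s − 3n₂`. -/
theorem twin_identity₂ (n : E3) :
    -((ℝ ∙ (!₂[(1 : ℝ), 1, 1] : E3))ᗮ.reflection n) =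
      (ℝ ∙ (EuclideanSpace.single 0 (1 : ℝ) - EuclideanSpace.single 1 (1 : ℝ)))ᗮ.reflection n -
        (2 * ⟪(!₂[(1 : ℝ), 1, -2] : E3),
          (ℝ ∙ (EuclideanSpace.single 0 (1 : ℝ) - EuclideanSpace.single 1 (1 : ℝ)))ᗮ.reflection n⟫_ℝ / 6) •
        (!₂[(1 : ℝ), 1, -2] : E3) ∧
    ⟪(!₂[(1 : ℝ), 1, -2] : E3),
        (ℝ ∙ (EuclideanSpace.single 0 (1 : ℝ) - EuclideanSpace.single 1 (1 : ℝ)))ᗮ.reflection n⟫_ℝ =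
      n 0 + n 1 + n 2 - 3 * n 2 := by
  obtain ⟨-, -, ⟨h0, h1, h2⟩⟩ := reflection_swap_coords n
  have hin : ⟪(!₂[(1 : ℝ), 1, -2] : E3),
      (ℝ ∙ (EuclideanSpace.single 0 (1 : ℝ) - EuclideanSpace.single 1 (1 : ℝ)))ᗮ.reflection n⟫_ℝ =
      n 0 + n 1 + n 2 - 3 * n 2 := by
    rw [(inner_cubic_vectors _).2.1, h0, h1, h2]; ring
  refine ⟨?_, hin⟩
  rw [neg_reflection_diag_apply, hin]
  ext l
  fin_cases l
  · simp [h0]; ring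
  · simp [h1]; ring
  · simp [h2]; ring

/-! ### The theorem -/

/-- **The twin section shift of the truncated octahedron is at most `sin∠(n,[111])/√6`.**  For the fcc
Wulff body `W = conv{perm(0,±1,±2)}`, the mirror `R` across `(1,1,1)^⊥`, every unit `n` and every `t`:
`|R W ∩ {⟪x, n⟫ < t}| ≤ |W ∩ {⟪x, n⟫ < t + (1/√6)·√(1 − ⟪n, (1,1,1)⟫²/3)}|`. -/
theorem fccWulffBody_twin_cdf_le (n : E3) (hn : ‖n‖ = 1) (t : ℝ) :
    volume ((ℝ ∙ (!₂[(1 : ℝ), 1, 1] : E3))ᗮ.reflection '' fccWulffBody ∩ {x : E3 | ⟪x, n⟫_ℝ < t}) ≤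
      volume (fccWulffBody ∩ {x : E3 | ⟪x, n⟫_ℝ < t +
        1 / Real.sqrt 6 * Real.sqrt (1 - ⟪n, (!₂[(1 : ℝ), 1, 1] : E3)⟫_ℝ ^ 2 / 3)}) := by
  set R := (ℝ ∙ (!₂[(1 : ℝ), 1, 1] : E3))ᗮ.reflection with hR
  set δ : ℝ := 1 / Real.sqrt 6 * Real.sqrt (1 - ⟪n, (!₂[(1 : ℝ), 1, 1] : E3)⟫_ℝ ^ 2 / 3) with hδ
  have hW : MeasurableSet (fccWulffBody : Set E3) := isCompact_fccWulffBody.measurableSet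
  -- (1) isometry covariance for the twin mirror, (2) central symmetry
  have h1 : volume (R '' fccWulffBody ∩ {x : E3 | ⟪x, n⟫_ℝ < t}) =
      volume (fccWulffBody ∩ {x : E3 | ⟪x, R n⟫_ℝ < t}) := by
    rw [volume_image_inter_halfSpace R hW n t, hR, Submodule.reflection_symm]
  have h2 : volume (fccWulffBody ∩ {x : E3 | ⟪x, R n⟫_ℝ < t}) =
      volume (fccWulffBody ∩ {x : E3 | ⟪x, -(R n)⟫_ℝ < t}) := by
    have h := volume_image_inter_halfSpace (LinearIsometryEquiv.neg ℝ : E3 ≃ₗᵢ[ℝ] E3) hW (R n) t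
    rw [neg_image_fccWulffBody] at h
    exact h
  rw [h1, h2]
  -- the sum of squares of the coordinates of the unit vector `n`
  have hs : ⟪n, (!₂[(1 : ℝ), 1, 1] : E3)⟫_ℝ = n 0 + n 1 + n 2 := by
    rw [real_inner_comm]; exact (inner_cubic_vectors n).1
  have hn2 : n 0 ^ 2 + n 1 ^ 2 + n 2 ^ 2 = 1 := by
    have h := hn
    rw [EuclideanSpace.norm_eq, Real.sqrt_eq_one, Fin.sum_univ_three] at h
    simpa only [Real.norm_eq_abs, sq_abs] using h
  -- the generic zone step
  have key : ∀ (dk v : E3), ‖dk‖ ^ 2 = 6 →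
      (∀ x ∈ fccWulffBody, 1 ≤ ⟪x, dk⟫_ℝ → x - (2 * (⟪x, dk⟫_ℝ - 1) / 6) • dk ∈ fccWulffBody) →
      (ℝ ∙ v)ᗮ.reflection '' fccWulffBody = fccWulffBody →
      -(R n) = (ℝ ∙ v)ᗮ.reflection n - (2 * ⟪dk, (ℝ ∙ v)ᗮ.reflection n⟫_ℝ / 6) • dk →
      2 * 1 * |⟪dk, (ℝ ∙ v)ᗮ.reflection n⟫_ℝ| / 6 ≤ δ →
      volume (fccWulffBody ∩ {x : E3 | ⟪x, -(R n)⟫_ℝ < t}) ≤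
        volume (fccWulffBody ∩ {x : E3 | ⟪x, n⟫_ℝ < t + δ}) := by
    intro dk v hN hcap hσW hid hδk
    rw [hid]
    have h := volume_inter_lt_reflect_le_of_cap_div convex_fccWulffBody isCompact_fccWulffBody
      (fun x hx => neg_mem_fccWulffBody hx) hN (by norm_num) hcap ((ℝ ∙ v)ᗮ.reflection n) t hδk
    have hσ : volume (fccWulffBody ∩ {x : E3 | ⟪x, (ℝ ∙ v)ᗮ.reflection n⟫_ℝ < t + δ}) =
        volume (fccWulffBody ∩ {x : E3 | ⟪x, n⟫_ℝ < t + δ}) := by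
      have h' := volume_image_inter_halfSpace ((ℝ ∙ v)ᗮ.reflection) hW ((ℝ ∙ v)ᗮ.reflection n) (t + δ)
      rw [hσW, Submodule.reflection_symm, Submodule.reflection_reflection] at h'
      exact h'
    rw [hσ] at h
    exact h
  rcases exists_zone_le (n 0) (n 1) (n 2) with hk | hk | hk
  · obtain ⟨hid, hin⟩ := twin_identity₀ n
    refine key _ _ norm_sq_cubic_vectors.2.2.2 (fun x hx hx1 => cap_reflect_mem_fccWulffBody₀ hx hx1)
      (reflection_swap_image_fccWulffBody (by decide)) hid ?_
    rw [hin, hδ, hs]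
    exact shift_le_of_sq_le (by rw [hn2, mul_one] at hk; exact hk)
  · obtain ⟨hid, hin⟩ := twin_identity₁ n
    refine key _ _ norm_sq_cubic_vectors.2.2.1 (fun x hx hx1 => cap_reflect_mem_fccWulffBody₁ hx hx1)
      (reflection_swap_image_fccWulffBody (by decide)) hid ?_
    rw [hin, hδ, hs]
    exact shift_le_of_sq_le (by rw [hn2, mul_one] at hk; exact hk)
  · obtain ⟨hid, hin⟩ := twin_identity₂ n
    refine key _ _ norm_sq_cubic_vectors.2.1 (fun x hx hx1 => cap_reflect_mem_fccWulffBody₂ hx hx1)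
      (reflection_swap_image_fccWulffBody (by decide)) hid ?_
    rw [hin, hδ, hs]
    exact shift_le_of_sq_le (by rw [hn2, mul_one] at hk; exact hk)

end Summit.Ventures.Crystal3D.Theorems

end
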